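import Mathlib
import HarnessLib
import HarnessLib.Audit
import Summits.ValiantsHypothesis.ValiantsHypothesis.Theorems.LacunarySymmetroidMatrixDescartesZeroChangeConcavityBudgetRise

/-!
# ValiantsHypothesis / LacunarySymmetroid — crux `MatrixDescartes` (stmt-ValiantsHypothesis-18050, V1), LINE (A) «product_plus_one»,
# floor `OneChangeFloorK3`: the HANKEL (Desnanot–Jacobi) law of the row Wronskian — ONE identity behind the push/drag log-concavity split

For a trinomial row `g = a₀ + a₁t^a + a₂t^c` (`row a c a₀ a₁ a₂`, ✓ `…ZeroChangeRows`) and the Euler operator `θ = t·d/dt`, the row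
Wronskian `W = g·θ²g − (θg)² = a²a₀a₁t^a + c²a₀a₂t^c + (c−a)²a₁a₂t^{a+c}` (✓ `rowWronskian_eval`) is again a three-term sum, with
`θW = a³a₀a₁t^a + c³a₀a₂t^c + (a+c)(c−a)²a₁a₂t^{a+c}` and `θ²W = a⁴a₀a₁t^a + c⁴a₀a₂t^c + (a+c)²(c−a)²a₁a₂t^{a+c}`.  The second step of the
θ-tower closes on the row itself:

* ★ `rowWronskian_hankel` — `W·θ²W − (θW)² = a²c²(c−a)²·a₀a₁a₂·t^{a+c}·g(t)` (Desnanot–Jacobi for the `3 × 3` Hankel determinant of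
  `(g, θg, θ²g, θ³g, θ⁴g)`, which for a three-letter exponential sum is `a₀a₁a₂·(0−a)²(0−c)²(a−c)²·t^{0+a+c}`); `hasDerivAt_rowWronskian`,
  `hasDerivAt_rowWronskianTheta` certify that the two closed forms ARE `t·W′` and `t·(θW)′`.

So the sign of the θ-log-concavity numerator of `|W|` is the sign of `a₀a₁a₂·g(t)` — ONE law for every type and phase, every ratio:

* `rowWronskian_hankel_pos_of_T5_unswitched` / `rowWronskian_hankel_neg_of_T5_switched` — an incoherent no-dip row `(+,−,−)`
  (`a₀ > 0`, `a₁, a₂ < 0`) has `|W|` strictly θ-log-CONVEX before its zero and `W` strictly θ-log-CONCAVE after it;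
* `rowWronskian_hankel_neg_of_T4_unswitched` / `…_pos_of_T4_switched` — a coherent no-dip row `(+,+,−)` the other way round;
  `rowWronskian_hankel_pos_of_T1` — a one-signed row `(+,+,+)`: `W` θ-log-convex everywhere;
* `rowWronskian_lt_of_T5_unswitched` — before its zero a `(+,−,−)` row has `W < −(θg)² ≤ 0` (so it is a pure DRAG there), and
  ★ `dragRate_logConvex_numerator_pos` — the cleared numerator `(W·θ²W − (θW)²)·g² − 2W³` of the θ-log-convexity of the drag rate
  `−W/g²` (`= −θφ`, `φ = θg/g`) is positive: every unswitched `(+,−,−)` trinomial drags log-convexly in `log t`, at EVERY ratio and with no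
  gap hypothesis (the compact form of ✓ `puller_slope_logConvex` / `rowPsi_slope_identity` of `…SlopeConvexity`, whose six-term certificate
  is this identity times `g²` minus `2W³`).

HONEST FRAMING: row calculus (helpers) — a one-line normal form of facts the line already uses cell by cell; it closes NO stub by name;
`OneChangeFloorK3`, `EulerBoundK3`, `ClassRowK3Linear`, `PPOPolyLaw`, `MatrixDescartes` (stmt-ValiantsHypothesis-18050) stay OPEN;
`VP ≠ VNP` is NOT proved and nothing here bears on it.  No definitions, no named facts, no sorry; Mathlib + the lane files.

[folklore] Desnanot–Jacobi / Sylvester identity for Hankel determinants of a three-term exponential sum; elementary algebra.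
-/

set_option linter.dupNamespace false

namespace Summit.ValiantsHypothesis.ValiantsHypothesis.Theorems.LacunarySymmetroidMatrixDescartes

namespace ZeroChange

open Polynomial

/-! ## The identity -/

/-- ★ **Hankel law of the row Wronskian** (Desnanot–Jacobi): with `W`, `θW`, `θ²W` in closed form,
`W·θ²W − (θW)² = a²c²(c−a)²·a₀a₁a₂·t^{a+c}·g(t)`. [folklore] -/
theorem rowWronskian_hankel (a c : ℕ) (a₀ a₁ a₂ t : ℝ) :
    ((a : ℝ) ^ 2 * a₀ * a₁ * t ^ a + (c : ℝ) ^ 2 * a₀ * a₂ * t ^ c + ((c : ℝ) - a) ^ 2 * a₁ * a₂ * t ^ (a + c))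
        * ((a : ℝ) ^ 4 * a₀ * a₁ * t ^ a + (c : ℝ) ^ 4 * a₀ * a₂ * t ^ c
            + ((a : ℝ) + c) ^ 2 * ((c : ℝ) - a) ^ 2 * a₁ * a₂ * t ^ (a + c))
      - ((a : ℝ) ^ 3 * a₀ * a₁ * t ^ a + (c : ℝ) ^ 3 * a₀ * a₂ * t ^ c
            + ((a : ℝ) + c) * ((c : ℝ) - a) ^ 2 * a₁ * a₂ * t ^ (a + c)) ^ 2
      = (a : ℝ) ^ 2 * (c : ℝ) ^ 2 * ((c : ℝ) - a) ^ 2 * (a₀ * a₁ * a₂) * t ^ (a + c)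
          * (row a c a₀ a₁ a₂).eval t := by
  rw [eval_row, pow_add]
  ring

/-! ## The closed forms ARE the θ-derivatives -/

/-- `t · d/dt (b·t^n) = n·b·t^n` in `HasDerivAt` form: `HasDerivAt (fun x => b * x ^ n) D t` with `t * D = n * b * t ^ n`. -/
private theorem hasDerivAt_monomial_theta (n : ℕ) (b t : ℝ) :
    ∃ D : ℝ, HasDerivAt (fun x : ℝ => b * x ^ n) D t ∧ t * D = (n : ℝ) * b * t ^ n := by
  refine ⟨b * ((n : ℝ) * t ^ (n - 1)), (hasDerivAt_pow n t).const_mul b, ?_⟩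
  rcases Nat.eq_zero_or_pos n with rfl | hn
  · simp
  · obtain ⟨k, rfl⟩ : ∃ k, n = k + 1 := ⟨n - 1, by omega⟩
    simp only [Nat.add_sub_cancel, pow_succ, Nat.cast_add, Nat.cast_one]
    ring

/-- **`θW` is `t·W′`:** the row Wronskian `W(x) = a²a₀a₁x^a + c²a₀a₂x^c + (c−a)²a₁a₂x^{a+c}` has a derivative `W′(t)` at `t` with
`t·W′(t) = a³a₀a₁t^a + c³a₀a₂t^c + (a+c)(c−a)²a₁a₂t^{a+c}`. -/
theorem hasDerivAt_rowWronskian (a c : ℕ) (a₀ a₁ a₂ t : ℝ) :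
    ∃ W' : ℝ, HasDerivAt (fun x : ℝ => (a : ℝ) ^ 2 * a₀ * a₁ * x ^ a + (c : ℝ) ^ 2 * a₀ * a₂ * x ^ c
        + ((c : ℝ) - a) ^ 2 * a₁ * a₂ * x ^ (a + c)) W' t ∧
      t * W' = (a : ℝ) ^ 3 * a₀ * a₁ * t ^ a + (c : ℝ) ^ 3 * a₀ * a₂ * t ^ c
        + ((a : ℝ) + c) * ((c : ℝ) - a) ^ 2 * a₁ * a₂ * t ^ (a + c) := by
  obtain ⟨D₁, h₁, e₁⟩ := hasDerivAt_monomial_theta a ((a : ℝ) ^ 2 * a₀ * a₁) t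
  obtain ⟨D₂, h₂, e₂⟩ := hasDerivAt_monomial_theta c ((c : ℝ) ^ 2 * a₀ * a₂) t
  obtain ⟨D₃, h₃, e₃⟩ := hasDerivAt_monomial_theta (a + c) (((c : ℝ) - a) ^ 2 * a₁ * a₂) t
  refine ⟨D₁ + D₂ + D₃, (h₁.add h₂).add h₃, ?_⟩
  have : t * (D₁ + D₂ + D₃) = t * D₁ + t * D₂ + t * D₃ := by ring
  rw [this, e₁, e₂, e₃]
  push_cast
  ring

/-- **`θ²W` is `t·(θW)′`:** `θW(x) = a³a₀a₁x^a + c³a₀a₂x^c + (a+c)(c−a)²a₁a₂x^{a+c}` has a derivative `V` at `t` with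
`t·V = a⁴a₀a₁t^a + c⁴a₀a₂t^c + (a+c)²(c−a)²a₁a₂t^{a+c}`. -/
theorem hasDerivAt_rowWronskianTheta (a c : ℕ) (a₀ a₁ a₂ t : ℝ) :
    ∃ V : ℝ, HasDerivAt (fun x : ℝ => (a : ℝ) ^ 3 * a₀ * a₁ * x ^ a + (c : ℝ) ^ 3 * a₀ * a₂ * x ^ c
        + ((a : ℝ) + c) * ((c : ℝ) - a) ^ 2 * a₁ * a₂ * x ^ (a + c)) V t ∧
      t * V = (a : ℝ) ^ 4 * a₀ * a₁ * t ^ a + (c : ℝ) ^ 4 * a₀ * a₂ * t ^ c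
        + ((a : ℝ) + c) ^ 2 * ((c : ℝ) - a) ^ 2 * a₁ * a₂ * t ^ (a + c) := by
  obtain ⟨D₁, h₁, e₁⟩ := hasDerivAt_monomial_theta a ((a : ℝ) ^ 3 * a₀ * a₁) t
  obtain ⟨D₂, h₂, e₂⟩ := hasDerivAt_monomial_theta c ((c : ℝ) ^ 3 * a₀ * a₂) t
  obtain ⟨D₃, h₃, e₃⟩ := hasDerivAt_monomial_theta (a + c) (((a : ℝ) + c) * ((c : ℝ) - a) ^ 2 * a₁ * a₂) t
  refine ⟨D₁ + D₂ + D₃, (h₁.add h₂).add h₃, ?_⟩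
  have : t * (D₁ + D₂ + D₃) = t * D₁ + t * D₂ + t * D₃ := by ring
  rw [this, e₁, e₂, e₃]
  push_cast
  ring

/-! ## Sign laws: the θ-log-concavity numerator of `W` has the sign of `a₀a₁a₂·g` -/

/-- **Incoherent row before its zero:** `a₀ > 0`, `a₁ < 0`, `a₂ < 0`, `0 < a < c`, `t > 0`, `g(t) > 0` ⇒ `W·θ²W − (θW)² > 0`
(`|W|` strictly θ-log-convex on the unswitched ray). -/
theorem rowWronskian_hankel_pos_of_T5_unswitched (a c : ℕ) (ha : 0 < a) (hac : a < c) {a₀ a₁ a₂ t : ℝ}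
    (h₀ : 0 < a₀) (h₁ : a₁ < 0) (h₂ : a₂ < 0) (ht : 0 < t) (hg : 0 < (row a c a₀ a₁ a₂).eval t) :
    0 < ((a : ℝ) ^ 2 * a₀ * a₁ * t ^ a + (c : ℝ) ^ 2 * a₀ * a₂ * t ^ c + ((c : ℝ) - a) ^ 2 * a₁ * a₂ * t ^ (a + c))
        * ((a : ℝ) ^ 4 * a₀ * a₁ * t ^ a + (c : ℝ) ^ 4 * a₀ * a₂ * t ^ c
            + ((a : ℝ) + c) ^ 2 * ((c : ℝ) - a) ^ 2 * a₁ * a₂ * t ^ (a + c))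
      - ((a : ℝ) ^ 3 * a₀ * a₁ * t ^ a + (c : ℝ) ^ 3 * a₀ * a₂ * t ^ c
            + ((a : ℝ) + c) * ((c : ℝ) - a) ^ 2 * a₁ * a₂ * t ^ (a + c)) ^ 2 := by
  rw [rowWronskian_hankel]
  have ha' : (0 : ℝ) < a := by exact_mod_cast ha
  have hc' : (0 : ℝ) < c := by exact_mod_cast (ha.trans hac)
  have hca : (0 : ℝ) < (c : ℝ) - a := by
    have : (a : ℝ) < c := by exact_mod_cast hac
    linarith
  have h012 : 0 < a₀ * a₁ * a₂ := by
    have : 0 < a₁ * a₂ := mul_pos_of_neg_of_neg h₁ h₂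
    nlinarith
  positivity

/-- **Incoherent row after its zero:** `a₀ > 0`, `a₁ < 0`, `a₂ < 0`, `0 < a < c`, `t > 0`, `g(t) < 0` ⇒ `W·θ²W − (θW)² < 0`
(`W` strictly θ-log-concave on the switched ray — the riser's push numerator). -/
theorem rowWronskian_hankel_neg_of_T5_switched (a c : ℕ) (ha : 0 < a) (hac : a < c) {a₀ a₁ a₂ t : ℝ}
    (h₀ : 0 < a₀) (h₁ : a₁ < 0) (h₂ : a₂ < 0) (ht : 0 < t) (hg : (row a c a₀ a₁ a₂).eval t < 0) :
    ((a : ℝ) ^ 2 * a₀ * a₁ * t ^ a + (c : ℝ) ^ 2 * a₀ * a₂ * t ^ c + ((c : ℝ) - a) ^ 2 * a₁ * a₂ * t ^ (a + c))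
        * ((a : ℝ) ^ 4 * a₀ * a₁ * t ^ a + (c : ℝ) ^ 4 * a₀ * a₂ * t ^ c
            + ((a : ℝ) + c) ^ 2 * ((c : ℝ) - a) ^ 2 * a₁ * a₂ * t ^ (a + c))
      - ((a : ℝ) ^ 3 * a₀ * a₁ * t ^ a + (c : ℝ) ^ 3 * a₀ * a₂ * t ^ c
            + ((a : ℝ) + c) * ((c : ℝ) - a) ^ 2 * a₁ * a₂ * t ^ (a + c)) ^ 2 < 0 := by
  rw [rowWronskian_hankel]
  have ha' : (0 : ℝ) < a := by exact_mod_cast ha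
  have hc' : (0 : ℝ) < c := by exact_mod_cast (ha.trans hac)
  have hca : (0 : ℝ) < (c : ℝ) - a := by
    have : (a : ℝ) < c := by exact_mod_cast hac
    linarith
  have h012 : 0 < a₀ * a₁ * a₂ := by
    have : 0 < a₁ * a₂ := mul_pos_of_neg_of_neg h₁ h₂
    nlinarith
  have hK : 0 < (a : ℝ) ^ 2 * (c : ℝ) ^ 2 * ((c : ℝ) - a) ^ 2 * (a₀ * a₁ * a₂) * t ^ (a + c) := by positivity
  exact mul_neg_of_pos_of_neg hK hg

/-- **Coherent row before its zero:** `a₀ > 0`, `a₁ > 0`, `a₂ < 0`, `0 < a < c`, `t > 0`, `g(t) > 0` ⇒ `W·θ²W − (θW)² < 0`. -/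
theorem rowWronskian_hankel_neg_of_T4_unswitched (a c : ℕ) (ha : 0 < a) (hac : a < c) {a₀ a₁ a₂ t : ℝ}
    (h₀ : 0 < a₀) (h₁ : 0 < a₁) (h₂ : a₂ < 0) (ht : 0 < t) (hg : 0 < (row a c a₀ a₁ a₂).eval t) :
    ((a : ℝ) ^ 2 * a₀ * a₁ * t ^ a + (c : ℝ) ^ 2 * a₀ * a₂ * t ^ c + ((c : ℝ) - a) ^ 2 * a₁ * a₂ * t ^ (a + c))
        * ((a : ℝ) ^ 4 * a₀ * a₁ * t ^ a + (c : ℝ) ^ 4 * a₀ * a₂ * t ^ c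
            + ((a : ℝ) + c) ^ 2 * ((c : ℝ) - a) ^ 2 * a₁ * a₂ * t ^ (a + c))
      - ((a : ℝ) ^ 3 * a₀ * a₁ * t ^ a + (c : ℝ) ^ 3 * a₀ * a₂ * t ^ c
            + ((a : ℝ) + c) * ((c : ℝ) - a) ^ 2 * a₁ * a₂ * t ^ (a + c)) ^ 2 < 0 := by
  rw [rowWronskian_hankel]
  have ha' : (0 : ℝ) < a := by exact_mod_cast ha
  have hc' : (0 : ℝ) < c := by exact_mod_cast (ha.trans hac)
  have hca : (0 : ℝ) < (c : ℝ) - a := by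
    have : (a : ℝ) < c := by exact_mod_cast hac
    linarith
  have h012 : a₀ * a₁ * a₂ < 0 := mul_neg_of_pos_of_neg (mul_pos h₀ h₁) h₂
  have hK : (a : ℝ) ^ 2 * (c : ℝ) ^ 2 * ((c : ℝ) - a) ^ 2 * (a₀ * a₁ * a₂) * t ^ (a + c) < 0 := by
    have hP : 0 < (a : ℝ) ^ 2 * (c : ℝ) ^ 2 * ((c : ℝ) - a) ^ 2 * t ^ (a + c) := by positivity
    nlinarith
  exact mul_neg_of_neg_of_pos hK hg

/-- **Coherent row after its zero:** `a₀ > 0`, `a₁ > 0`, `a₂ < 0`, `0 < a < c`, `t > 0`, `g(t) < 0` ⇒ `W·θ²W − (θW)² > 0`. -/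
theorem rowWronskian_hankel_pos_of_T4_switched (a c : ℕ) (ha : 0 < a) (hac : a < c) {a₀ a₁ a₂ t : ℝ}
    (h₀ : 0 < a₀) (h₁ : 0 < a₁) (h₂ : a₂ < 0) (ht : 0 < t) (hg : (row a c a₀ a₁ a₂).eval t < 0) :
    0 < ((a : ℝ) ^ 2 * a₀ * a₁ * t ^ a + (c : ℝ) ^ 2 * a₀ * a₂ * t ^ c + ((c : ℝ) - a) ^ 2 * a₁ * a₂ * t ^ (a + c))
        * ((a : ℝ) ^ 4 * a₀ * a₁ * t ^ a + (c : ℝ) ^ 4 * a₀ * a₂ * t ^ c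
            + ((a : ℝ) + c) ^ 2 * ((c : ℝ) - a) ^ 2 * a₁ * a₂ * t ^ (a + c))
      - ((a : ℝ) ^ 3 * a₀ * a₁ * t ^ a + (c : ℝ) ^ 3 * a₀ * a₂ * t ^ c
            + ((a : ℝ) + c) * ((c : ℝ) - a) ^ 2 * a₁ * a₂ * t ^ (a + c)) ^ 2 := by
  rw [rowWronskian_hankel]
  have ha' : (0 : ℝ) < a := by exact_mod_cast ha
  have hc' : (0 : ℝ) < c := by exact_mod_cast (ha.trans hac)
  have hca : (0 : ℝ) < (c : ℝ) - a := by
    have : (a : ℝ) < c := by exact_mod_cast hac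
    linarith
  have h012 : a₀ * a₁ * a₂ < 0 := mul_neg_of_pos_of_neg (mul_pos h₀ h₁) h₂
  have hK : (a : ℝ) ^ 2 * (c : ℝ) ^ 2 * ((c : ℝ) - a) ^ 2 * (a₀ * a₁ * a₂) * t ^ (a + c) < 0 := by
    have hP : 0 < (a : ℝ) ^ 2 * (c : ℝ) ^ 2 * ((c : ℝ) - a) ^ 2 * t ^ (a + c) := by positivity
    nlinarith
  exact mul_pos_of_neg_of_neg hK hg

/-- **One-signed row:** `a₀, a₁, a₂ > 0`, `0 < a < c`, `t > 0` ⇒ `W·θ²W − (θW)² > 0` (`W` θ-log-convex everywhere). -/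
theorem rowWronskian_hankel_pos_of_T1 (a c : ℕ) (ha : 0 < a) (hac : a < c) {a₀ a₁ a₂ t : ℝ}
    (h₀ : 0 < a₀) (h₁ : 0 < a₁) (h₂ : 0 < a₂) (ht : 0 < t) :
    0 < ((a : ℝ) ^ 2 * a₀ * a₁ * t ^ a + (c : ℝ) ^ 2 * a₀ * a₂ * t ^ c + ((c : ℝ) - a) ^ 2 * a₁ * a₂ * t ^ (a + c))
        * ((a : ℝ) ^ 4 * a₀ * a₁ * t ^ a + (c : ℝ) ^ 4 * a₀ * a₂ * t ^ c
            + ((a : ℝ) + c) ^ 2 * ((c : ℝ) - a) ^ 2 * a₁ * a₂ * t ^ (a + c))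
      - ((a : ℝ) ^ 3 * a₀ * a₁ * t ^ a + (c : ℝ) ^ 3 * a₀ * a₂ * t ^ c
            + ((a : ℝ) + c) * ((c : ℝ) - a) ^ 2 * a₁ * a₂ * t ^ (a + c)) ^ 2 := by
  rw [rowWronskian_hankel, eval_row]
  have ha' : (0 : ℝ) < a := by exact_mod_cast ha
  have hc' : (0 : ℝ) < c := by exact_mod_cast (ha.trans hac)
  have hca : (0 : ℝ) < (c : ℝ) - a := by
    have : (a : ℝ) < c := by exact_mod_cast hac
    linarith
  positivity

/-! ## The drag rate of an unswitched incoherent row is θ-log-convex -/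

/-- **Before its zero an incoherent row is a pure drag:** `a₀ > 0`, `a₁, a₂ ≤ 0` not both zero, `0 < a`, `0 < c`, `t > 0`,
`g(t) ≥ 0` ⇒ `W(t) < 0` — indeed `W = g·θ²g − (θg)²` with `θ²g = a²a₁t^a + c²a₂t^c < 0`. -/
theorem rowWronskian_lt_of_T5_unswitched (a c : ℕ) (ha : 0 < a) (hc : 0 < c) {a₀ a₁ a₂ t : ℝ}
    (h₁ : a₁ ≤ 0) (h₂ : a₂ ≤ 0) (h12 : a₁ < 0 ∨ a₂ < 0) (ht : 0 < t) (hg : 0 ≤ (row a c a₀ a₁ a₂).eval t) :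
    (a : ℝ) ^ 2 * a₀ * a₁ * t ^ a + (c : ℝ) ^ 2 * a₀ * a₂ * t ^ c + ((c : ℝ) - a) ^ 2 * a₁ * a₂ * t ^ (a + c)
      < 0 := by
  have ha' : (0 : ℝ) < a := by exact_mod_cast ha
  have hc' : (0 : ℝ) < c := by exact_mod_cast hc
  have hta : 0 < t ^ a := pow_pos ht a
  have htc : 0 < t ^ c := pow_pos ht c
  -- `W = g·θ²g − (θg)²`
  have hW : (a : ℝ) ^ 2 * a₀ * a₁ * t ^ a + (c : ℝ) ^ 2 * a₀ * a₂ * t ^ c + ((c : ℝ) - a) ^ 2 * a₁ * a₂ * t ^ (a + c)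
      = (row a c a₀ a₁ a₂).eval t * ((a : ℝ) ^ 2 * a₁ * t ^ a + (c : ℝ) ^ 2 * a₂ * t ^ c)
        - ((a : ℝ) * a₁ * t ^ a + (c : ℝ) * a₂ * t ^ c) ^ 2 := by
    rw [eval_row, pow_add]; ring
  rw [hW]
  have hθ2 : (a : ℝ) ^ 2 * a₁ * t ^ a + (c : ℝ) ^ 2 * a₂ * t ^ c < 0 := by
    rcases h12 with h1 | h2
    · have : (a : ℝ) ^ 2 * a₁ * t ^ a < 0 := by
        have : 0 < (a : ℝ) ^ 2 * t ^ a := by positivity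
        nlinarith
      have : (c : ℝ) ^ 2 * a₂ * t ^ c ≤ 0 := by
        have : 0 < (c : ℝ) ^ 2 * t ^ c := by positivity
        nlinarith
      linarith
    · have : (c : ℝ) ^ 2 * a₂ * t ^ c < 0 := by
        have : 0 < (c : ℝ) ^ 2 * t ^ c := by positivity
        nlinarith
      have : (a : ℝ) ^ 2 * a₁ * t ^ a ≤ 0 := by
        have : 0 < (a : ℝ) ^ 2 * t ^ a := by positivity
        nlinarith
      linarith
  have hθ1 : (a : ℝ) * a₁ * t ^ a + (c : ℝ) * a₂ * t ^ c < 0 := by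
    rcases h12 with h1 | h2
    · have : (a : ℝ) * a₁ * t ^ a < 0 := by
        have : 0 < (a : ℝ) * t ^ a := by positivity
        nlinarith
      have : (c : ℝ) * a₂ * t ^ c ≤ 0 := by
        have : 0 < (c : ℝ) * t ^ c := by positivity
        nlinarith
      linarith
    · have : (c : ℝ) * a₂ * t ^ c < 0 := by
        have : 0 < (c : ℝ) * t ^ c := by positivity
        nlinarith
      have : (a : ℝ) * a₁ * t ^ a ≤ 0 := by
        have : 0 < (a : ℝ) * t ^ a := by positivity
        nlinarith
      linarith
  have hsq : 0 < ((a : ℝ) * a₁ * t ^ a + (c : ℝ) * a₂ * t ^ c) ^ 2 := by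
    have := hθ1.ne
    positivity
  nlinarith [mul_nonneg hg (le_of_lt (neg_pos.2 hθ2))]

/-- ★ **The drag rate `−W/g²` of an unswitched incoherent trinomial is strictly θ-log-convex** (cleared numerator; every ratio, no gap
hypothesis): with `N = W·θ²W − (θW)²` (the Hankel numerator) one has `D²·θ²(log D) = (N·g² − 2W³)/g⁶` for `D = −W/g²` (because
`θ² log D = N/W² − 2·(g θ²g − (θg)²)/g² = N/W² − 2W/g²`), and `N·g² − 2W³ > 0` for `a₀ > 0`, `a₁ < 0`, `a₂ < 0`, `g(t) > 0`. -/
theorem dragRate_logConvex_numerator_pos (a c : ℕ) (ha : 0 < a) (hac : a < c) {a₀ a₁ a₂ t : ℝ}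
    (h₀ : 0 < a₀) (h₁ : a₁ < 0) (h₂ : a₂ < 0) (ht : 0 < t) (hg : 0 < (row a c a₀ a₁ a₂).eval t) :
    0 < (((a : ℝ) ^ 2 * a₀ * a₁ * t ^ a + (c : ℝ) ^ 2 * a₀ * a₂ * t ^ c + ((c : ℝ) - a) ^ 2 * a₁ * a₂ * t ^ (a + c))
          * ((a : ℝ) ^ 4 * a₀ * a₁ * t ^ a + (c : ℝ) ^ 4 * a₀ * a₂ * t ^ c
              + ((a : ℝ) + c) ^ 2 * ((c : ℝ) - a) ^ 2 * a₁ * a₂ * t ^ (a + c))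
        - ((a : ℝ) ^ 3 * a₀ * a₁ * t ^ a + (c : ℝ) ^ 3 * a₀ * a₂ * t ^ c
              + ((a : ℝ) + c) * ((c : ℝ) - a) ^ 2 * a₁ * a₂ * t ^ (a + c)) ^ 2)
          * ((row a c a₀ a₁ a₂).eval t) ^ 2
      - 2 * ((a : ℝ) ^ 2 * a₀ * a₁ * t ^ a + (c : ℝ) ^ 2 * a₀ * a₂ * t ^ c
              + ((c : ℝ) - a) ^ 2 * a₁ * a₂ * t ^ (a + c)) ^ 3 := by
  have hN := rowWronskian_hankel_pos_of_T5_unswitched a c ha hac h₀ h₁ h₂ ht hg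
  have hW := rowWronskian_lt_of_T5_unswitched a c ha (ha.trans hac) h₁.le h₂.le (Or.inl h₁) ht hg.le
  have hg2 : 0 < ((row a c a₀ a₁ a₂).eval t) ^ 2 := by positivity
  have hW3 : ((a : ℝ) ^ 2 * a₀ * a₁ * t ^ a + (c : ℝ) ^ 2 * a₀ * a₂ * t ^ c
              + ((c : ℝ) - a) ^ 2 * a₁ * a₂ * t ^ (a + c)) ^ 3 < 0 := by
    exact Odd.pow_neg (by decide : Odd 3) hW
  nlinarith [mul_pos hN hg2]

/-! ## The push rate of a switched incoherent row past its knee is θ-log-concave (appended, same hand) -/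

/-- ★ **The push rate `W/g²` of a switched incoherent trinomial past its knee is strictly θ-log-concave** (cleared numerator; every
ratio): for `a₀ > 0`, `a₁ < 0`, `a₂ < 0`, `g(t) < 0` (switched) and `W(t) > 0` (past the knee, ✓ `rowWronskian_nonneg_persist`), the numerator
`(W·θ²W − (θW)²)·g² − 2W³` of `(W/g²)²·θ² log(W/g²)` (`θ² log(W/g²) = (Wθ²W − (θW)²)/W² − 2W/g²`) is NEGATIVE — the riser pushes log-concavely
(compact normal form of ✓ `riser_slope_logConcave`; dual of `dragRate_logConvex_numerator_pos`). -/
theorem pushRate_logConcave_numerator_neg (a c : ℕ) (ha : 0 < a) (hac : a < c) {a₀ a₁ a₂ t : ℝ}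
    (h₀ : 0 < a₀) (h₁ : a₁ < 0) (h₂ : a₂ < 0) (ht : 0 < t) (hg : (row a c a₀ a₁ a₂).eval t < 0)
    (hW : 0 < (a : ℝ) ^ 2 * a₀ * a₁ * t ^ a + (c : ℝ) ^ 2 * a₀ * a₂ * t ^ c + ((c : ℝ) - a) ^ 2 * a₁ * a₂ * t ^ (a + c)) :
    (((a : ℝ) ^ 2 * a₀ * a₁ * t ^ a + (c : ℝ) ^ 2 * a₀ * a₂ * t ^ c + ((c : ℝ) - a) ^ 2 * a₁ * a₂ * t ^ (a + c))
          * ((a : ℝ) ^ 4 * a₀ * a₁ * t ^ a + (c : ℝ) ^ 4 * a₀ * a₂ * t ^ c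
              + ((a : ℝ) + c) ^ 2 * ((c : ℝ) - a) ^ 2 * a₁ * a₂ * t ^ (a + c))
        - ((a : ℝ) ^ 3 * a₀ * a₁ * t ^ a + (c : ℝ) ^ 3 * a₀ * a₂ * t ^ c
              + ((a : ℝ) + c) * ((c : ℝ) - a) ^ 2 * a₁ * a₂ * t ^ (a + c)) ^ 2)
          * ((row a c a₀ a₁ a₂).eval t) ^ 2
      - 2 * ((a : ℝ) ^ 2 * a₀ * a₁ * t ^ a + (c : ℝ) ^ 2 * a₀ * a₂ * t ^ c
              + ((c : ℝ) - a) ^ 2 * a₁ * a₂ * t ^ (a + c)) ^ 3 < 0 := by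
  have hN := rowWronskian_hankel_neg_of_T5_switched a c ha hac h₀ h₁ h₂ ht hg
  have hg2 : 0 < ((row a c a₀ a₁ a₂).eval t) ^ 2 := by
    rw [sq]; exact mul_pos_of_neg_of_neg hg hg
  have hW3 : 0 < ((a : ℝ) ^ 2 * a₀ * a₁ * t ^ a + (c : ℝ) ^ 2 * a₀ * a₂ * t ^ c
              + ((c : ℝ) - a) ^ 2 * a₁ * a₂ * t ^ (a + c)) ^ 3 := pow_pos hW 3
  nlinarith [mul_neg_of_neg_of_pos hN hg2]

/-- **The knee lies after the zero** (contrapositive packaging of `rowWronskian_lt_of_T5_unswitched`): for an incoherent row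
(`a₁, a₂ ≤ 0`, not both zero, `0 < a`, `0 < c`, `t > 0`), `W(t) ≥ 0` forces `g(t) < 0` — a row past its knee is switched. -/
theorem switched_of_rowWronskian_nonneg (a c : ℕ) (ha : 0 < a) (hc : 0 < c) {a₀ a₁ a₂ t : ℝ}
    (h₁ : a₁ ≤ 0) (h₂ : a₂ ≤ 0) (h12 : a₁ < 0 ∨ a₂ < 0) (ht : 0 < t)
    (hW : 0 ≤ (a : ℝ) ^ 2 * a₀ * a₁ * t ^ a + (c : ℝ) ^ 2 * a₀ * a₂ * t ^ c + ((c : ℝ) - a) ^ 2 * a₁ * a₂ * t ^ (a + c)) :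
    (row a c a₀ a₁ a₂).eval t < 0 := by
  by_contra hge
  exact absurd hW (not_le.2 (rowWronskian_lt_of_T5_unswitched a c ha hc h₁ h₂ h12 ht (not_lt.1 hge)))

end ZeroChange

end Summit.ValiantsHypothesis.ValiantsHypothesis.Theorems.LacunarySymmetroidMatrixDescartes
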